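import Summits.HodgeConjecture.CorCM.Census.QuaternionColumnEvenFibre
import Summits.HodgeConjecture.CorCM.Census.BlockParityBurnside

/-!
# The quaternion column, block count: `c ∈ ⟨g⟩ ⟺ ord g` even in `Q_{4n}`, Burnside for the dicyclic column, and `μ(Q_{2^{m+2}}) = 4^n/(4n)`

COR-CM (cell `pub-hodgecm2`), count-neutral kernel combinatorics by the binder seat b09 (gen 40; lane RELATIVE SPLITTING, part XI), on b09 gen 28ʼs Burnside count
`BlockParity.card_block_mul_card` (`β·|G| = Σ_g [c ∉ ⟨g⟩]·2^{|G|/ord g/2}`), gen 40ʼs closed form `fibreTwo_eq_card_block` and laws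
`isLeast_card_gfaces_generate_quaternion_even_card_block`, gen 39ʼs `isLeast_card_gfaces_generate_quaternion`, all BY NAME.  Theorems only: no definition, no `decide`
beyond closed identities, no certificate, no named fact, no `sorry`.
HONEST FRAMING: `HC_CM` is NOT proved, here or anywhere in the tree; nothing here is a period or a headline.

* §1 `c = a n` is the UNIQUE involution of `Q_{4n}` (`eq_c_of_mul_self_eq_one`), so `c ∈ ⟨g⟩ ⟺ orderOf g` is even (`c_mem_zpowers_iff_even_orderOf`, every `n ≥ 1`).
* §2 **Burnside for the dicyclic column** (`card_block_mul_card_quaternion`): `β(Q_{4n}, c) · 4n = Σ_{g : ord g odd} 2^{2n / ord g}` — the odd-order elements are the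
  rotations in the odd part of `⟨a⟩`; for `n = 2^m` only `g = 1` survives: **`β(Q_{2^{m+2}}) · 4n = 2^{2n}`** (`card_block_mul_card_of_two_pow`).
* §3 **THE EXPLICIT COUNT** (`isLeast_card_gfaces_generate_quaternion_two_pow_explicit`): for `n = 2^m ≥ 4` the least number of face relations whose base changes
  generate the Hodge lattice of `(Q_{4n}, c)` modulo pairs is EXACTLY `2^{2n} / (4n) = 4^{n−1}/n` (`16` for `Q₁₆`, `2048` for `Q₃₂`, `2^26` for `Q₆₄`); for general even
  `n = 2^a m'` the law `μ = β` of part X with §2 gives `μ(Q_{4n}) · 4n = Σ_{d ∣ m'} φ(d)·2^{2n/d}` (`172` for `Q₂₄`, numerically).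

## References
* [Pohlmann1968] H. Pohlmann, Algebraic cycles on abelian varieties of complex multiplication type, Ann. of Math. 88 (1968), Thm 1.
* [Milne1999] J. S. Milne, Lefschetz motives and the Tate conjecture, Compositio Math. 117 (1999), Prop. 2.1, p. 54.
-/

namespace Summit.HodgeConjecture.CorCM.Census.QuaternionColumn

open Finset QuaternionGroup
open Summit.HodgeConjecture.CorCM.Prior.AllgGroup.RfwfAllgGroup
open Summit.HodgeConjecture.CorCM.Census.BlockParity
open Summit.HodgeConjecture.CorCM.Census.Coinvariant

noncomputable section

variable {n : ℕ} [NeZero n]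

/-! ## §1 The unique involution and the parity criterion -/

/-- **`c` is the unique involution of `Q_{4n}`**: `x·x = 1`, `x ≠ 1 ⟹ x = c`. [folklore] -/
theorem eq_c_of_mul_self_eq_one {x : QuaternionGroup n} (hx : x * x = 1) (hx1 : x ≠ 1) : x = c n := by
  have hn := NeZero.ne n
  cases x with
  | xa j => rw [xa_mul_xa_self] at hx; exact absurd hx c_ne_one
  | a i =>
    rw [a_mul_a, one_def] at hx
    have h2 : i + i = 0 := QuaternionGroup.a.inj hx
    have hi0 : i ≠ 0 := fun h => hx1 (by rw [h, one_def])
    -- `2 i = 0` in `ℤ/2n` with `i ≠ 0` forces `i = n`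
    have hval : i.val + i.val = 2 * n ∨ i.val + i.val = 0 := by
      have hlt := ZMod.val_lt i
      have hdvd : 2 * n ∣ i.val + i.val := by
        have e : ((i.val + i.val : ℕ) : ZMod (2 * n)) = 0 := by rw [Nat.cast_add, ZMod.natCast_zmod_val, h2]
        exact (ZMod.natCast_eq_zero_iff _ _).mp e
      obtain ⟨k, hk⟩ := hdvd
      have hk2 : k < 2 := by nlinarith
      interval_cases k <;> omega
    rcases hval with h | h
    · have hi : i.val = n := by omega
      show a i = a (n : ZMod (2 * n))
      rw [← ZMod.natCast_zmod_val i, hi]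
    · exact absurd ((ZMod.val_eq_zero i).mp (by omega)) hi0

/-- **`c ∈ ⟨g⟩ ⟺ orderOf g` is even**, for every element `g` of `Q_{4n}` (`n ≥ 1`). [folklore] -/
theorem c_mem_zpowers_iff_even_orderOf (g : QuaternionGroup n) : c n ∈ Subgroup.zpowers g ↔ Even (orderOf g) := by
  have hoc : orderOf (c n) = 2 := orderOf_eq_prime (by rw [pow_two]; exact c_mul_c) c_ne_one
  constructor
  · intro h
    have hd := orderOf_dvd_of_mem_zpowers h
    rw [hoc] at hd
    exact even_iff_two_dvd.mpr hd
  · rintro ⟨k, hk⟩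
    have hk2 : orderOf g = 2 * k := by omega
    have hkpos : 0 < k := by have := orderOf_pos g; omega
    have hx : orderOf (g ^ k) = 2 := by
      rw [orderOf_pow' g hkpos.ne', hk2, Nat.gcd_mul_left_left, Nat.mul_div_cancel 2 hkpos]
    have hsq : g ^ k * g ^ k = 1 := by rw [← pow_two, ← hx]; exact pow_orderOf_eq_one _
    have hne : g ^ k ≠ 1 := fun h => by rw [h, orderOf_one] at hx; exact absurd hx (by norm_num)
    rw [← eq_c_of_mul_self_eq_one hsq hne]
    exact Subgroup.pow_mem _ (Subgroup.mem_zpowers g) k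

/-! ## §2 Burnside for the dicyclic column -/

/-- **BURNSIDE FOR `Q_{4n}`**: `β(Q_{4n}, c) · 4n = Σ_{g : orderOf g odd} 2^{4n / orderOf g / 2}`. [folklore] -/
theorem card_block_mul_card_quaternion :
    Fintype.card (Block (c n)) * (4 * n) = ∑ g : QuaternionGroup n, if Even (orderOf g) then 0 else 2 ^ (4 * n / orderOf g / 2) := by
  have h := card_block_mul_card (c n) c_mul_c c_comm
  rw [QuaternionGroup.card] at h
  rw [h]
  exact Finset.sum_congr rfl fun g _ => by simp only [c_mem_zpowers_iff_even_orderOf]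

/-- For `n = 2^m` every non-identity element of `Q_{4n}` has even order. [folklore] -/
theorem even_orderOf_of_ne_one (m : ℕ) (hn : n = 2 ^ m) {g : QuaternionGroup n} (hg : g ≠ 1) : Even (orderOf g) := by
  have hdvd : orderOf g ∣ 2 ^ (m + 2) := by
    have h := orderOf_dvd_card (G := QuaternionGroup n) (x := g)
    rw [QuaternionGroup.card] at h
    have e : 4 * n = 2 ^ (m + 2) := by rw [hn]; ring
    rwa [e] at h
  obtain ⟨k, -, hk⟩ := (Nat.dvd_prime_pow Nat.prime_two).mp hdvd
  have hk0 : k ≠ 0 := by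
    rintro rfl
    rw [pow_zero, orderOf_eq_one_iff] at hk
    exact hg hk
  rw [hk]
  exact (Nat.even_pow' hk0).mpr (by norm_num)

/-- **`β(Q_{2^{m+2}}) · 4n = 2^{2n}`** (`n = 2^m`): in Burnsideʼs count only the identity survives. [folklore] -/
theorem card_block_mul_card_of_two_pow (m : ℕ) (hn : n = 2 ^ m) : Fintype.card (Block (c n)) * (4 * n) = 2 ^ (2 * n) := by
  have hnz := NeZero.ne n
  rw [card_block_mul_card_quaternion, Finset.sum_eq_single (1 : QuaternionGroup n)]
  · rw [orderOf_one, if_neg (by decide), Nat.div_one, show 4 * n / 2 = 2 * n by omega]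
  · intro g _ hg
    rw [if_pos (even_orderOf_of_ne_one m hn hg)]
  · intro h; exact absurd (Finset.mem_univ _) h

/-! ## §3 The explicit count for the generalized quaternion `2`-groups -/

/-- **`μ(Q_{2^{m+2}}, c) = 2^{2n}/(4n) = 4^{n−1}/n`** (`n = 2^m ≥ 4`): the least number of rank-four face relations whose base changes generate the integer Hodge
lattice of `(Q_{4n}, c)` modulo pairs, as an explicit number. [folklore] -/
theorem isLeast_card_gfaces_generate_quaternion_two_pow_explicit (m : ℕ) (hn : n = 2 ^ m) (h4 : 4 ≤ n) :
    IsLeast {k : ℕ | ∃ S : Finset (CMF (QuaternionGroup n) (c n) →₀ ℤ), (↑S ⊆ gfaceSet (QuaternionGroup n) (c n) c_mul_c) ∧ S.card = k ∧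
      hodgeSpan (c n) c_mul_c ≤ Submodule.span ℤ (pairSet (c n)) ⊔ Submodule.span ℤ (translates (c n) S)} (2 ^ (2 * n) / (4 * n)) := by
  have hnz := NeZero.ne n
  have heven : Even n := by
    have hm : m ≠ 0 := by rintro rfl; rw [hn] at h4; norm_num at h4
    rw [hn]; exact (Nat.even_pow' hm).mpr (by norm_num)
  have hβ : Fintype.card (Block (c n)) = 2 ^ (2 * n) / (4 * n) := by
    rw [← card_block_mul_card_of_two_pow m hn, Nat.mul_div_cancel _ (by omega)]
  rw [← hβ]
  exact isLeast_card_gfaces_generate_quaternion_even_card_block heven h4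

end

end Summit.HodgeConjecture.CorCM.Census.QuaternionColumn
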